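import Literature.Analysis.FluidPDE.SelfSimilarEulerProfileVorticity
import Mathlib.Analysis.Calculus.Deriv.Slope
import Mathlib.Analysis.InnerProductSpace.PiL2
import HarnessLib

/-!
# Constantin–Ignatova–Vicol 2026, Theorem 3.8: an outgoing stagnation point carrying vorticity
# forces `γ ≥ ½ + c_*` — proofs companion

Analysis/FluidPDE proofs file (theorems only: no definitions, no named facts), second companion of
`SelfSimilarEulerProfile.lean` (request `defn-IsSelfSimilarEulerProfile`, route
`NavierStokesRegularity/VortexLineClock`, crux `EmptyEulerWindow`: "under the local OUTGOING property
`γ ≥ 1/2` (CIV Thms 3.8, 3.10)"). We PROVE CIV Theorem 3.8 for the tree's predicates (centre `c`):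

> *Let `U` be a `C²` smooth globally self-similar velocity profile for 3D incompressible Euler. If
> there exists `y_* ∈ 𝒩_V` such that `Ω(y_*) ≠ 0`, and if the local outgoing property (3.37) holds
> in an open neighborhood of `y = y_*` for some `c_* ≥ 0`, then `γ ≥ ½ + c_*`.*

following the printed proof:

* `IsSelfSimilarEulerVorticityProfile.fderiv_apply_curl_eq_of_mem_nodalSet` — at a stagnation
  point `z` (`V(z) = 0`) the vorticity equation (3.4) reads `DU(z) Ω(z) = Ω(z)`: `Ω(z)` is an
  eigenvector of `DU(z)` (equivalently of the rate of strain `𝕊_z`) with eigenvalue `1`;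
* `le_inner_fderiv_of_outgoing` — the outgoing inequality `V(y)·(y − z) ≥ c_*|y − z|²` near a zero
  `z` of a differentiable field linearises to `⟪DV(z) h, h⟫ ≥ c_*|h|²` ("passing `y → y_*`"; here
  along rays, by the slope limit `t⁻¹ V(z + t h) → DV(z) h`), and `DV = γ I + DU`;
* `one_add_mul_le_trace_of_apply_eq_self` — if `A e = e`, `|e| = 1` and `⟪A h, h⟫ ≥ q|h|²` then
  `tr A ≥ 1 + (n − 1) q` in dimension `n` (trace in an orthonormal basis through `e`; CIV phrase
  this via the eigenvalues of the traceless symmetric `𝕊_{y_*}`: `λ_min ≥ c_* − γ`, hence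
  `λ_max ≤ 2(γ − c_*)`, and `1` is an eigenvalue);
* `IsSelfSimilarEulerVorticityProfile.half_add_le_of_outgoing` — **Theorem 3.8**: with
  `tr DU(z) = div U(z) = 0` and `n = 3`, `0 ≥ 1 + 2(c_* − γ)`, i.e. `γ ≥ ½ + c_*`; packaged with
  Definition 3.7 (`.half_add_le_of_isLocallyOutgoing`, `.half_le_of_isLocallyOutgoing`), with
  Elgindi's global property (3.36) (`.half_add_le_of_isGloballyOutgoing`), and for velocity-form
  profiles (`IsSelfSimilarEulerProfile.half_add_le_of_isLocallyOutgoing`, via (3.3) ⇒ (3.4)).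

The hypothesis `c_* ≥ 0` of the paper is not needed for the inequality `γ ≥ ½ + c_*` itself (any
real `κ`). NOT here: CIV Prop. 3.9 (vanishing of `Ω` to infinite order when `γ < ½ + c_*`) and
Thm. 3.10 (`γ ≥ ½` under analyticity at the nodal set, via the Lagrangian flow and the Cauchy
formula).

## References

* P. Constantin, M. Ignatova, V. Vicol, *On putative self-similarity for incompressible 3D Euler*,
  arXiv:2602.17570 (2026), §3.5 Definition 3.7, (3.36)–(3.37), Theorem 3.8 and its proof
  [ConstantinIgnatovaVicol2026Putative].
-/

noncomputable section

open Set InnerProductSpace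
open scoped RealInnerProductSpace

namespace Literature.Analysis.FluidPDE

/-! ### CIV Theorem 3.8: an outgoing stagnation point carrying vorticity forces `γ ≥ ½ + c_*` -/

section OutgoingOneHalf

section QuadraticForm

variable {E : Type*} [NormedAddCommGroup E] [InnerProductSpace ℝ E]

/-- **Linearisation of the local outgoing property at a zero** (CIV, proof of Thm. 3.8: "since
`V(y_*) = 0`, `V(y)·(y−y_*) = (y−y_*)⊗(y−y_*) : ∇V(y_*) + O(|y−y_*|³)` … passing `y → y_*`"). If `V`
is differentiable at `z` with derivative `L`, `V(z) = 0`, and `V(y)·(y − z) ≥ κ|y − z|²` for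
`|y − z| ≤ ε` (`ε > 0`), then the quadratic form of `L` is bounded below: `⟪L h, h⟫ ≥ κ|h|²` for
all `h` (restrict to the ray `y = z + t h`, `t ↓ 0`, and use the slope limit
`t⁻¹ V(z + t h) → L h`). [cite: ConstantinIgnatovaVicol2026Putative, §3.5 proof of Thm. 3.8] -/
theorem le_inner_fderiv_of_outgoing {V : E → E} {L : E →L[ℝ] E} {z : E} {κ ε : ℝ}
    (hV : HasFDerivAt V L z) (hz : V z = 0) (hε : 0 < ε)
    (hout : ∀ y, ‖y - z‖ ≤ ε → κ * ‖y - z‖ ^ 2 ≤ ⟪V y, y - z⟫) (h : E) :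
    κ * ‖h‖ ^ 2 ≤ ⟪L h, h⟫ := by
  by_cases hh : h = 0
  · simp [hh]
  have hnorm : 0 < ‖h‖ := norm_pos_iff.2 hh
  -- the restriction of `V` to the ray `t ↦ z + t • h`
  have hline : HasDerivAt (fun t : ℝ => z + t • h) h 0 := by
    simpa using ((hasDerivAt_id (0 : ℝ)).smul_const h).const_add z
  have hg : HasDerivAt (fun t : ℝ => V (z + t • h)) (L h) 0 :=
    hV.comp_hasDerivAt_of_eq 0 hline (by simp)
  have hT := hg.tendsto_slope_zero_right
  simp only [zero_add, zero_smul, add_zero, hz, sub_zero] at hT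
  -- hT : Tendsto (fun t => t⁻¹ • V (z + t • h)) (𝓝[>] 0) (𝓝 (L h))
  have hT2 : Filter.Tendsto (fun t : ℝ => ⟪t⁻¹ • V (z + t • h), h⟫) (nhdsWithin 0 (Ioi 0))
      (nhds ⟪L h, h⟫) := hT.inner tendsto_const_nhds
  refine ge_of_tendsto hT2 ?_
  have hmem : Ioo (0 : ℝ) (ε / ‖h‖) ∈ nhdsWithin (0 : ℝ) (Ioi 0) := Ioo_mem_nhdsGT (by positivity)
  filter_upwards [hmem] with t ht
  have ht0 : 0 < t := ht.1
  have htε : ‖(z + t • h) - z‖ ≤ ε := by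
    rw [add_sub_cancel_left, norm_smul, Real.norm_eq_abs, abs_of_pos ht0]
    have := ht.2
    rw [lt_div_iff₀ hnorm] at this
    exact this.le
  have key := hout (z + t • h) htε
  rw [add_sub_cancel_left, norm_smul, Real.norm_eq_abs, abs_of_pos ht0, inner_smul_right] at key
  -- key : κ * (t * ‖h‖) ^ 2 ≤ t * ⟪V (z + t • h), h⟫
  rw [inner_smul_left, conj_trivial]
  have ht2 : 0 < t ^ 2 := by positivity
  have e1 : t⁻¹ * ⟪V (z + t • h), h⟫ = (t * ⟪V (z + t • h), h⟫) / t ^ 2 := by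
    field_simp
  rw [e1, le_div_iff₀ ht2]
  nlinarith [key]

end QuadraticForm

section Trace

variable {E : Type*} [NormedAddCommGroup E] [InnerProductSpace ℝ E] [FiniteDimensional ℝ E]

/-- **The trace inequality behind CIV Thm. 3.8** (dimension-free form of "the eigenvalues of the
traceless symmetric matrix `𝕊_{y_*}` lie in `[c_* − γ, 2(γ − c_*)]` and `1` is one of them"): if a
linear map `A` fixes a unit vector `e` and its quadratic form satisfies `⟪A h, h⟫ ≥ q|h|²`, then
`tr A ≥ 1 + (n − 1) q`, `n = dim E` (expand the trace in an orthonormal basis through `e`).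
[cite: ConstantinIgnatovaVicol2026Putative, §3.5 proof of Thm. 3.8] -/
theorem one_add_mul_le_trace_of_apply_eq_self {A : E →L[ℝ] E} {e : E} (he : ‖e‖ = 1)
    (hAe : A e = e) {q : ℝ} (hq : ∀ h, q * ‖h‖ ^ 2 ≤ ⟪A h, h⟫) :
    1 + ((Module.finrank ℝ E : ℝ) - 1) * q ≤ LinearMap.trace ℝ E (A : E →ₗ[ℝ] E) := by
  classical
  -- an orthonormal basis through `e`
  have hon : Orthonormal ℝ ((↑) : ({e} : Set E) → E) := by
    rw [orthonormal_subtype_iff_ite]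
    intro v hv w hw
    rw [Set.mem_singleton_iff] at hv hw
    subst hv; subst hw
    simp [he]
  obtain ⟨u, b, heu, hb⟩ := hon.exists_orthonormalBasis_extension
  have he_mem : e ∈ u := by
    have : e ∈ ({e} : Set E) := Set.mem_singleton e
    exact_mod_cast heu this
  have hcard : (Module.finrank ℝ E : ℝ) = u.card := by
    rw [Module.finrank_eq_card_basis b.toBasis, Fintype.card_coe]
  -- expand the trace
  rw [LinearMap.trace_eq_sum_inner _ b]
  have hsum : ∑ i, ⟪b i, (A : E →ₗ[ℝ] E) (b i)⟫ = ∑ x ∈ u, ⟪x, A x⟫ := by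
    rw [← Finset.sum_coe_sort u (fun x => ⟪x, A x⟫)]
    refine Finset.sum_congr rfl fun i _ => ?_
    rw [hb]
    rfl
  rw [hsum, ← Finset.add_sum_erase u _ he_mem, hAe, real_inner_self_eq_norm_sq, he, one_pow]
  -- each remaining term is at least `q`
  have hterm : ∀ x ∈ u.erase e, q ≤ ⟪x, A x⟫ := by
    intro x hx
    have hxu : x ∈ u := Finset.mem_of_mem_erase hx
    have hx1 : ‖x‖ = 1 := by
      have := b.orthonormal.1 ⟨x, hxu⟩
      rw [hb] at this
      exact this
    have := hq x
    rw [hx1, one_pow, mul_one, real_inner_comm] at this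
    exact this
  have hle := Finset.card_nsmul_le_sum (u.erase e) (fun x => ⟪x, A x⟫) q hterm
  rw [Finset.card_erase_of_mem he_mem, nsmul_eq_mul, Nat.cast_sub (Finset.card_pos.2 ⟨e, he_mem⟩),
    Nat.cast_one] at hle
  rw [hcard]
  linarith

end Trace

namespace IsSelfSimilarEulerVorticityProfile

variable {γ : ℝ} {c : (EuclideanSpace ℝ (Fin 3))}
variable {U : (EuclideanSpace ℝ (Fin 3)) → (EuclideanSpace ℝ (Fin 3))}

/-- At a stagnation point `y_*` of the transport field (`V(y_*) = 0`) the vorticity is an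
eigenvector of the velocity gradient with eigenvalue one: `DU(y_*) Ω(y_*) = Ω(y_*)` (CIV, proof of
Thm. 3.8: "restricting (3.38) to `y = y_*`, the matrix `𝕊_{y_*}` has `1` as an eigenvalue, with
eigenvector `Ω(y_*)`"). [cite: ConstantinIgnatovaVicol2026Putative, §3.5 proof of Thm. 3.8] -/
theorem fderiv_apply_curl_eq_of_mem_nodalSet (h : IsSelfSimilarEulerVorticityProfile γ c U)
    {z : (EuclideanSpace ℝ (Fin 3))} (hz : z ∈ selfSimilarNodalSet γ c U) :
    fderiv ℝ U z (curl U z) = curl U z := by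
  have e := h.vorticity_eq z
  rw [mem_selfSimilarNodalSet_iff] at hz
  rw [hz, map_zero, add_zero] at e
  exact e.symm

/-- **Constantin–Ignatova–Vicol, Theorem 3.8** (for the tree's vorticity-form profiles, centre
`c`). Let `U` be a `C²` self-similar velocity profile (vorticity form (3.4)). If `y_* = z` is a
stagnation point of `V = γ(y−c) + U` with `Ω(z) ≠ 0`, `Ω = curl U`, and the outgoing inequality
`V(y)·(y − z) ≥ c_*|y − z|²` holds for `|y − z| ≤ ε_*` (`c_* = κ`, any sign; `ε_* = ε > 0`), then
`γ ≥ ½ + c_*`. Proof as printed: `DU(z)` has the eigenvector `Ω(z)` with eigenvalue `1`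
(`fderiv_apply_curl_eq_of_mem_nodalSet`); the outgoing inequality linearises to
`⟪(γ I + DU(z)) h, h⟫ ≥ c_*|h|²` (`le_inner_fderiv_of_outgoing`); and `tr DU(z) = div U(z) = 0`, so
expanding the trace in an orthonormal basis through `Ω(z)/|Ω(z)|` gives `0 ≥ 1 + 2(c_* − γ)`
(`one_add_mul_le_trace_of_apply_eq_self`, `dim = 3`). [cite: ConstantinIgnatovaVicol2026Putative, §3.5 Thm. 3.8] -/
theorem half_add_le_of_outgoing (h : IsSelfSimilarEulerVorticityProfile γ c U)
    {z : (EuclideanSpace ℝ (Fin 3))}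
    (hz : z ∈ selfSimilarNodalSet γ c U) (hΩ : curl U z ≠ 0) {κ ε : ℝ} (hε : 0 < ε)
    (hout : ∀ y, ‖y - z‖ ≤ ε → κ * ‖y - z‖ ^ 2 ≤ ⟪selfSimilarTransport γ c U y, y - z⟫) :
    1 / 2 + κ ≤ γ := by
  -- the derivative of `V` at `z`
  have hU : HasFDerivAt U (fderiv ℝ U z) z :=
    ((h.contDiff_velocity.differentiable (by norm_num)) z).hasFDerivAt
  have hV : HasFDerivAt (selfSimilarTransport γ c U)
      (γ • ContinuousLinearMap.id ℝ (EuclideanSpace ℝ (Fin 3)) + fderiv ℝ U z) z :=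
    (((hasFDerivAt_id z).sub_const c).fun_const_smul γ).fun_add hU
  have hVz : selfSimilarTransport γ c U z = 0 := hz
  -- linearised outgoing property: `⟪DU h, h⟫ ≥ (κ − γ)|h|²`
  have hq : ∀ v : (EuclideanSpace ℝ (Fin 3)), (κ - γ) * ‖v‖ ^ 2 ≤ ⟪fderiv ℝ U z v, v⟫ := by
    intro v
    have e := le_inner_fderiv_of_outgoing hV hVz hε hout v
    rw [_root_.add_apply, _root_.smul_apply, ContinuousLinearMap.id_apply, inner_add_left,
      inner_smul_left, conj_trivial, real_inner_self_eq_norm_sq] at e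
    linarith
  -- the unit eigenvector `Ω(z)/|Ω(z)|`
  set e : (EuclideanSpace ℝ (Fin 3)) := ‖curl U z‖⁻¹ • curl U z with he_def
  have hn : ‖curl U z‖ ≠ 0 := norm_ne_zero_iff.2 hΩ
  have he1 : ‖e‖ = 1 := by
    rw [he_def, norm_smul, norm_inv, norm_norm, inv_mul_cancel₀ hn]
  have hAe : fderiv ℝ U z e = e := by
    rw [he_def, map_smul, h.fderiv_apply_curl_eq_of_mem_nodalSet hz]
  -- trace inequality in dimension three, `tr DU(z) = div U(z) = 0`
  have htr := one_add_mul_le_trace_of_apply_eq_self he1 hAe hq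
  have hdiv :
      LinearMap.trace ℝ _ (fderiv ℝ U z : (EuclideanSpace ℝ (Fin 3)) →ₗ[ℝ] (EuclideanSpace ℝ (Fin 3))) = 0 :=
    h.divFree z
  rw [hdiv, finrank_euclideanSpace, Fintype.card_fin] at htr
  norm_num at htr
  linarith

/-- **CIV Theorem 3.8 with the local outgoing property of Definition 3.7**: if the transport field
of a `C²` vorticity-form profile is locally outgoing with constants `(c_*, ε_*) = (κ, ε)` and some
stagnation point carries vorticity, `Ω(y_*) ≠ 0`, then `γ ≥ ½ + c_*`; in particular `γ ≥ ½`.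
[cite: ConstantinIgnatovaVicol2026Putative, §3.5 Thm. 3.8] -/
theorem half_add_le_of_isLocallyOutgoing (h : IsSelfSimilarEulerVorticityProfile γ c U) {κ ε : ℝ}
    (hout : IsLocallyOutgoing γ c U κ ε) {z : (EuclideanSpace ℝ (Fin 3))}
    (hz : z ∈ selfSimilarNodalSet γ c U)
    (hΩ : curl U z ≠ 0) : 1 / 2 + κ ≤ γ :=
  h.half_add_le_of_outgoing hz hΩ hout.pos (hout.outgoing z hz)

/-- **CIV Theorem 3.8, conclusion `γ ≥ ½`** (the constant `c_* ≥ 0` dropped). [cite: ConstantinIgnatovaVicol2026Putative, §3.5 Thm. 3.8] -/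
theorem half_le_of_isLocallyOutgoing (h : IsSelfSimilarEulerVorticityProfile γ c U) {κ ε : ℝ}
    (hout : IsLocallyOutgoing γ c U κ ε) {z : (EuclideanSpace ℝ (Fin 3))}
    (hz : z ∈ selfSimilarNodalSet γ c U)
    (hΩ : curl U z ≠ 0) : 1 / 2 ≤ γ := by
  linarith [h.half_add_le_of_isLocallyOutgoing hout hz hΩ, hout.nonneg]

/-- **CIV Theorem 3.8 under Elgindi's global outgoing property (3.36)**: if `V` is globally
outgoing with constant `c_* = κ > 0`, the centre is a stagnation point (`U(c) = 0`, e.g. under the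
far-field bounds (3.8)) and `Ω(c) ≠ 0`, then `γ ≥ ½ + c_*` (CIV: (3.36) implies the local outgoing
property with `𝒩_V = {0}`). [cite: ConstantinIgnatovaVicol2026Putative, §3.5 Thm. 3.8 with (3.36)] -/
theorem half_add_le_of_isGloballyOutgoing (h : IsSelfSimilarEulerVorticityProfile γ c U) {κ : ℝ}
    (hout : IsGloballyOutgoing γ c U κ) (hUc : U c = 0) (hΩ : curl U c ≠ 0) : 1 / 2 + κ ≤ γ :=
  h.half_add_le_of_isLocallyOutgoing (hout.isLocallyOutgoing one_pos)
    (center_mem_selfSimilarNodalSet_iff.2 hUc) hΩ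

end IsSelfSimilarEulerVorticityProfile

/-- **CIV Theorem 3.8 for velocity-form profiles** (via (3.3) ⇒ (3.4)). [cite: ConstantinIgnatovaVicol2026Putative, §3.5 Thm. 3.8] -/
theorem IsSelfSimilarEulerProfile.half_add_le_of_isLocallyOutgoing {γ : ℝ}
    {c : (EuclideanSpace ℝ (Fin 3))} {U : (EuclideanSpace ℝ (Fin 3)) → (EuclideanSpace ℝ (Fin 3))}
    {P : (EuclideanSpace ℝ (Fin 3)) → ℝ}
    (h : IsSelfSimilarEulerProfile γ c U P) {κ ε : ℝ} (hout : IsLocallyOutgoing γ c U κ ε)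
    {z : (EuclideanSpace ℝ (Fin 3))} (hz : z ∈ selfSimilarNodalSet γ c U) (hΩ : curl U z ≠ 0) :
    1 / 2 + κ ≤ γ :=
  h.isSelfSimilarEulerVorticityProfile.half_add_le_of_isLocallyOutgoing hout hz hΩ

end OutgoingOneHalf

end Literature.Analysis.FluidPDE
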